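import Literature.NumberTheory.Automorphic.CuspidalCohomologyGL
import Literature.NumberTheory.Automorphic.CompletedCohomology
import HarnessLib

/-!
# Hecke operators of elements normalising the level into itself: pull-back, push-forward, `T_{g⁻¹} T_g = deg`

Topic `NumberTheory/Automorphic`; namespace `Literature.NumberTheory.Automorphic`, grouping
sub-namespaces `ArithmeticQuotient` / `TwistedQuotient` (as `CuspidalCohomologyGL`).  A *proofs*
file (theorems only), universe-polymorphic.

For a level `L ≤ 𝒢` and an element `g` with `g⁻¹ L g ⊆ L` (a "contracting" element; e.g.
`g = diag(1, ϖ) ∈ B(F_w)` for the level `B(𝒪_w)` of the Borel subgroup, or any element of a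
positive Weyl chamber for an Iwahori level):

* `L g L = g L` is a single coset, so `T_g = [L g L]` is the PULL-BACK along the (surjective,
  `deg(g⁻¹)`-to-one) map `m_g : 𝒢/L → 𝒢/L`, `xL ↦ x g L`: `(T_g f)(xL) = f(x g L)`
  (the tree's `heckeFun_apply_mk_of_conj` of `OrdinaryCompletedCohomologyGL`, for `Type`; a
  universe-polymorphic private copy is used here);
* `T_{g⁻¹} = [L g⁻¹ L]` is the PUSH-FORWARD along `m_g` (sum over the fibres), and
  **`T_{g⁻¹} ∘ T_g = deg(g⁻¹) · id`**, `deg(g⁻¹) = #(L g⁻¹ L / L) = [L : L ∩ g L g⁻¹]`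
  (`heckeFun_inv_comp_heckeFun_of_conj`); in particular `T_g` is injective whenever
  `deg(g⁻¹)` is not a zero-divisor of the coefficients, and on every FINITE-DIMENSIONAL
  Hecke-stable space over a field of characteristic `0` it is invertible with
  `T_{g⁻¹} = deg(g⁻¹) T_g⁻¹`;
* for `z` central, `L z g L / L = z · (L g L / L)` and **`T_{z g} = T_g ∘ (f ↦ f(z ·))`**
  (`heckeFun_central_mul`), so that e.g. `T_{diag(ϖ,1)} = T_{ϖ·1} ∘ T_{diag(1,ϖ)⁻¹}` for the Borel
  level;
* the same identities for the operators on `H^q(S_L, Ṽ)` (`TwistedQuotient.heckeEnd_…`).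

These are the relations of the local Hecke algebra of `(B(F_w), B(𝒪_w))` used in the computation
of the Hecke eigenvalues on the cohomology of the Borel stratum [Harder1987, §2]; as abstract
double-coset identities they are [ShimuraIATAF1971, Ch. 3, §3.1, Prop. 3.1–3.3].

## References

* G. Shimura, *Introduction to the arithmetic theory of automorphic functions* (1971), Ch. 3, §3.1
  [ShimuraIATAF1971].
* G. Harder, *Eisenstein cohomology of arithmetic groups. The case GL₂*, Invent. Math. 89 (1987), §2
  [Harder1987].
-/

noncomputable section

open CategoryTheory

universe u

namespace Literature.NumberTheory.Automorphic

namespace ArithmeticQuotient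

variable (k : Type u) [CommRing k] {𝒢 : Type u} [Group 𝒢] (L : Subgroup 𝒢)
  (M : Type u) [AddCommGroup M] [Module k M]

/-! ### `L g L = g L` for `g⁻¹ L g ⊆ L` -/

variable {k M} in
/-- If `g⁻¹ L g ⊆ L` then `L g L / L = {g L}` (universe-polymorphic private copy of the tree's
`doubleCosetQuot_eq_singleton_of_conj`, which is stated for `Type`). [cite: ShimuraIATAF1971, Ch. 3, §3.1] -/
private theorem doubleCosetQuot_eq_singleton_of_conj' {g : 𝒢} (hg : ∀ l ∈ L, g⁻¹ * l * g ∈ L) :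
    doubleCosetQuot L g = {(g : 𝒢 ⧸ L)} := by
  ext d
  simp only [Set.mem_singleton_iff, doubleCosetQuot]
  constructor
  · rintro ⟨l, rfl⟩
    change ((l : 𝒢) • (g : 𝒢 ⧸ L)) = _
    rw [MulAction.Quotient.smul_coe, smul_eq_mul, QuotientGroup.eq]
    simpa [mul_assoc] using hg _ (L.inv_mem l.2)
  · rintro rfl
    exact MulAction.mem_orbit_self _

variable {k M} in
/-- `L g L / L` is finite (a singleton) when `g⁻¹ L g ⊆ L`. [folklore] -/
theorem finite_doubleCosetQuot_of_conj {g : 𝒢} (hg : ∀ l ∈ L, g⁻¹ * l * g ∈ L) :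
    (doubleCosetQuot L g).Finite := by
  rw [doubleCosetQuot_eq_singleton_of_conj' L hg]; exact Set.finite_singleton _

/-- **`T_g` is pull-back along `xL ↦ xgL`** when `g⁻¹ L g ⊆ L`: `(T_g f)(xL) = f(x g L)`
(universe-polymorphic private copy of the tree's `heckeFun_apply_mk_of_conj`, stated for `Type`).
[cite: ShimuraIATAF1971, Ch. 3, §3.1] -/
private theorem heckeFun_apply_coe_of_conj {g : 𝒢} (hg : ∀ l ∈ L, g⁻¹ * l * g ∈ L) (f : (𝒢 ⧸ L) → M)
    (x : 𝒢) : heckeFun k L g M f (x : 𝒢 ⧸ L) = f ((x * g : 𝒢) : 𝒢 ⧸ L) := by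
  classical
  have hfin := finite_doubleCosetQuot_of_conj L hg
  have hset : hfin.toFinset = {(g : 𝒢 ⧸ L)} :=
    Finset.ext fun d => by rw [Set.Finite.mem_toFinset, doubleCosetQuot_eq_singleton_of_conj' L hg]; simp
  rw [heckeFun_apply_coe k L M g f x hfin, hset, Finset.sum_singleton, MulAction.Quotient.smul_coe,
    smul_eq_mul]

/-- The map `m_g : xL ↦ x g L` on `𝒢 ⧸ L` (well defined when `g⁻¹ L g ⊆ L`). [folklore] -/
theorem mk_mul_eq_mk_mul_of_conj {g : 𝒢} (hg : ∀ l ∈ L, g⁻¹ * l * g ∈ L) {x y : 𝒢}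
    (hxy : (x : 𝒢 ⧸ L) = (y : 𝒢 ⧸ L)) : ((x * g : 𝒢) : 𝒢 ⧸ L) = ((y * g : 𝒢) : 𝒢 ⧸ L) := by
  rw [QuotientGroup.eq] at hxy ⊢
  have : (x * g)⁻¹ * (y * g) = g⁻¹ * (x⁻¹ * y) * g := by group
  rw [this]
  exact hg _ hxy

/-! ### `T_{g⁻¹} ∘ T_g = deg(g⁻¹)` -/

/-- **Push–pull**: for `g⁻¹ L g ⊆ L` and `L g⁻¹ L / L` finite,
`T_{g⁻¹} (T_g f) = #(L g⁻¹ L / L) • f` — the fibre of `m_g : xL ↦ xgL` over `xL` is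
`x · (L g⁻¹ L / L)`, on which `T_g f` is constant `= f(xL)`. [cite: ShimuraIATAF1971, Ch. 3, §3.1, Prop. 3.3] -/
theorem heckeFun_inv_apply_heckeFun_of_conj {g : 𝒢} (hg : ∀ l ∈ L, g⁻¹ * l * g ∈ L)
    (hfin : (doubleCosetQuot L g⁻¹).Finite) (f : (𝒢 ⧸ L) → M) :
    heckeFun k L g⁻¹ M (heckeFun k L g M f) = hfin.toFinset.card • f := by
  classical
  funext c
  induction c using QuotientGroup.induction_on with
  | H x =>
  rw [heckeFun_apply_coe k L M g⁻¹ _ x hfin, Pi.smul_apply, ← Finset.sum_const]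
  refine Finset.sum_congr rfl fun d hd => ?_
  rw [Set.Finite.mem_toFinset] at hd
  obtain ⟨l, rfl⟩ := hd
  change heckeFun k L g M f (x • (l : 𝒢) • ((g⁻¹ : 𝒢) : 𝒢 ⧸ L)) = f (x : 𝒢 ⧸ L)
  rw [MulAction.Quotient.smul_coe, MulAction.Quotient.smul_coe, smul_eq_mul, smul_eq_mul,
    heckeFun_apply_coe_of_conj k L M hg, mul_assoc, mul_assoc, inv_mul_cancel, mul_one,
    QuotientGroup.mk_mul_of_mem x l.2]

/-- The same as an identity of linear maps: `T_{g⁻¹} ∘ T_g = #(L g⁻¹ L / L) • id`.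
[cite: ShimuraIATAF1971, Ch. 3, §3.1, Prop. 3.3] -/
theorem heckeFun_inv_comp_heckeFun_of_conj {g : 𝒢} (hg : ∀ l ∈ L, g⁻¹ * l * g ∈ L)
    (hfin : (doubleCosetQuot L g⁻¹).Finite) :
    heckeFun k L g⁻¹ M ∘ₗ heckeFun k L g M = hfin.toFinset.card • LinearMap.id :=
  LinearMap.ext fun f => heckeFun_inv_apply_heckeFun_of_conj k L M hg hfin f

/-- Hence `T_g` is injective as soon as `deg(g⁻¹)` is not a zero-divisor on `Fun(𝒢 ⧸ L, M)`
(e.g. `M` a vector space over a field of characteristic `0`). [folklore] -/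
theorem heckeFun_injective_of_conj {g : 𝒢} (hg : ∀ l ∈ L, g⁻¹ * l * g ∈ L)
    (hfin : (doubleCosetQuot L g⁻¹).Finite)
    (hreg : ∀ f : (𝒢 ⧸ L) → M, hfin.toFinset.card • f = 0 → f = 0) :
    Function.Injective (heckeFun k L g M) := by
  intro f f' hff'
  have h := congrArg (heckeFun k L g⁻¹ M) hff'
  rw [heckeFun_inv_apply_heckeFun_of_conj k L M hg hfin,
    heckeFun_inv_apply_heckeFun_of_conj k L M hg hfin] at h
  have h0 : hfin.toFinset.card • (f - f') = 0 := by rw [smul_sub, h, sub_self]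
  exact sub_eq_zero.1 (hreg _ h0)

/-! ### Central factors: `T_{z g} = T_g ∘ (z ·)` -/

/-- For `z` central, `L (z g) L / L = z · (L g L / L)`. [folklore] -/
theorem doubleCosetQuot_central_mul {z : 𝒢} (hz : z ∈ Subgroup.center 𝒢) (g : 𝒢) :
    doubleCosetQuot L (z * g) = (z • ·) '' doubleCosetQuot L g := by
  ext d
  simp only [doubleCosetQuot, Set.mem_image]
  constructor
  · rintro ⟨l, rfl⟩
    refine ⟨(l : 𝒢) • (g : 𝒢 ⧸ L), ⟨l, rfl⟩, ?_⟩
    change z • (l : 𝒢) • (g : 𝒢 ⧸ L) = (l : 𝒢) • ((z * g : 𝒢) : 𝒢 ⧸ L)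
    rw [MulAction.Quotient.smul_coe, MulAction.Quotient.smul_coe, MulAction.Quotient.smul_coe,
      smul_eq_mul, smul_eq_mul, smul_eq_mul, ← mul_assoc, ← mul_assoc,
      Subgroup.mem_center_iff.1 hz (l : 𝒢)]
  · rintro ⟨_, ⟨l, rfl⟩, rfl⟩
    refine ⟨l, ?_⟩
    change (l : 𝒢) • ((z * g : 𝒢) : 𝒢 ⧸ L) = z • (l : 𝒢) • (g : 𝒢 ⧸ L)
    rw [MulAction.Quotient.smul_coe, MulAction.Quotient.smul_coe, MulAction.Quotient.smul_coe,
      smul_eq_mul, smul_eq_mul, smul_eq_mul, ← mul_assoc, ← mul_assoc,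
      Subgroup.mem_center_iff.1 hz (l : 𝒢)]

/-- Finiteness of `L (zg) L / L` follows from that of `L g L / L` for `z` central. [folklore] -/
theorem finite_doubleCosetQuot_central_mul {z : 𝒢} (hz : z ∈ Subgroup.center 𝒢) {g : 𝒢}
    (hfin : (doubleCosetQuot L g).Finite) : (doubleCosetQuot L (z * g)).Finite := by
  rw [doubleCosetQuot_central_mul L hz g]; exact hfin.image _

/-- **`T_{z g} f = T_g (f ∘ (z ·))`** for `z` central (and `L g L / L` finite).
[cite: ShimuraIATAF1971, Ch. 3, §3.1] -/
theorem heckeFun_central_mul {z : 𝒢} (hz : z ∈ Subgroup.center 𝒢) {g : 𝒢}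
    (hfin : (doubleCosetQuot L g).Finite) (f : (𝒢 ⧸ L) → M) :
    heckeFun k L (z * g) M f = heckeFun k L g M (fun c => f (z • c)) := by
  classical
  have hfin' := finite_doubleCosetQuot_central_mul L hz hfin
  have hset : hfin'.toFinset = hfin.toFinset.image (z • ·) :=
    Finset.ext fun d => by
      rw [Set.Finite.mem_toFinset, doubleCosetQuot_central_mul L hz g, Finset.mem_image]
      simp only [Set.mem_image, Set.Finite.mem_toFinset]
  funext c
  induction c using QuotientGroup.induction_on with
  | H x =>
  rw [heckeFun_apply_coe k L M (z * g) f x hfin', heckeFun_apply_coe k L M g _ x hfin, hset,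
    Finset.sum_image fun a _ b _ hab => smul_left_cancel z hab]
  refine Finset.sum_congr rfl fun d _ => ?_
  induction d using QuotientGroup.induction_on with
  | H y =>
  rw [MulAction.Quotient.smul_coe, MulAction.Quotient.smul_coe, MulAction.Quotient.smul_coe,
    MulAction.Quotient.smul_coe, smul_eq_mul, smul_eq_mul, smul_eq_mul, smul_eq_mul, ← mul_assoc,
    ← mul_assoc, Subgroup.mem_center_iff.1 hz x]

/-- Left translations commute with every `T_g` (right convolution):
`T_g (f ∘ (z ·)) = (T_g f) ∘ (z ·)` for any `z ∈ 𝒢`. [folklore] -/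
theorem heckeFun_comp_smul (z g : 𝒢) (f : (𝒢 ⧸ L) → M) :
    heckeFun k L g M (fun c => f (z • c)) = fun c => heckeFun k L g M f (z • c) := by
  classical
  funext c
  by_cases hfin : (doubleCosetQuot L g).Finite
  · induction c using QuotientGroup.induction_on with
    | H x =>
    rw [heckeFun_apply_coe k L M g _ x hfin, MulAction.Quotient.smul_coe, smul_eq_mul,
      heckeFun_apply_coe k L M g f (z * x) hfin]
    refine Finset.sum_congr rfl fun d _ => ?_
    rw [mul_smul]
  · rw [heckeFun_apply, dif_neg hfin, heckeFun_apply, dif_neg hfin]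

end ArithmeticQuotient

/-! ### On twisted cohomology -/

namespace TwistedQuotient

variable {k : Type u} [CommRing k] {Γ 𝒢 : Type u} [Group Γ] [Group 𝒢]
variable (ι : Γ →* 𝒢) (L : Subgroup 𝒢) {V : Type u} [AddCommGroup V] [Module k V]
  (ρ : Representation k Γ V)

/-- `[L g⁻¹ L] ≫`-form of push–pull on the representation `Fun(𝒢 ⧸ L, V)`:
`T_g ≫ T_{g⁻¹} = deg(g⁻¹) • 𝟙`. [cite: ShimuraIATAF1971, Ch. 3, §3.1, Prop. 3.3] -/
theorem heckeRepHom_comp_heckeRepHom_inv_of_conj {g : 𝒢} (hg : ∀ l ∈ L, g⁻¹ * l * g ∈ L)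
    (hfin : (ArithmeticQuotient.doubleCosetQuot L g⁻¹).Finite) :
    heckeRepHom ι L ρ g ≫ heckeRepHom ι L ρ g⁻¹ = hfin.toFinset.card • 𝟙 (coeffRep ι L ρ) := by
  refine Rep.hom_ext (Representation.IntertwiningMap.ext (LinearMap.ext fun f => ?_))
  change ArithmeticQuotient.heckeFun k L g⁻¹ V (ArithmeticQuotient.heckeFun k L g V f) =
    (hfin.toFinset.card • (𝟙 (coeffRep ι L ρ) : coeffRep ι L ρ ⟶ coeffRep ι L ρ)).hom f
  rw [ArithmeticQuotient.heckeFun_inv_apply_heckeFun_of_conj k L V hg hfin f, Rep.nsmul_hom]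
  rfl

/-- **Push–pull on `H^q(S_L, Ṽ)`**: `T_{g⁻¹} (T_g x) = deg(g⁻¹) • x` for `g⁻¹ L g ⊆ L`.
[cite: ShimuraIATAF1971, Ch. 3, §3.1, Prop. 3.3] [cite: Harder1987, §2] -/
theorem heckeEnd_inv_apply_heckeEnd_of_conj {g : 𝒢} (hg : ∀ l ∈ L, g⁻¹ * l * g ∈ L)
    (hfin : (ArithmeticQuotient.doubleCosetQuot L g⁻¹).Finite) (q : ℕ) (x : cohomology ι L ρ q) :
    heckeEnd ι L ρ g⁻¹ q (heckeEnd ι L ρ g q x) = hfin.toFinset.card • x := by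
  change (heckeOperator ι L ρ g q ≫ heckeOperator ι L ρ g⁻¹ q).hom x = _
  rw [heckeOperator, heckeOperator, ← groupCohomology.map_id_comp,
    heckeRepHom_comp_heckeRepHom_inv_of_conj ι L ρ hg hfin]
  -- `H^q(id, n • 𝟙) = n • 𝟙`
  have hns : ∀ n : ℕ, (groupCohomology.map (MonoidHom.id Γ)
      (n • 𝟙 (coeffRep ι L ρ)) q).hom x = n • x := by
    intro n
    induction n with
    | zero =>
      rw [zero_smul, zero_smul]
      change (HomologicalComplex.homologyMap ((groupCohomology.cochainsFunctor k Γ).map 0) q).hom x = 0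
      rw [(groupCohomology.cochainsFunctor k Γ).map_zero, HomologicalComplex.homologyMap_zero]
      rfl
    | succ n ih =>
      rw [add_smul, one_smul, add_smul, one_smul]
      change (HomologicalComplex.homologyMap ((groupCohomology.cochainsFunctor k Γ).map
        (n • 𝟙 (coeffRep ι L ρ) + 𝟙 _)) q).hom x = _
      rw [(groupCohomology.cochainsFunctor k Γ).map_add, HomologicalComplex.homologyMap_add,
        ModuleCat.hom_add, LinearMap.add_apply]
      change (groupCohomology.map (MonoidHom.id Γ) (n • 𝟙 (coeffRep ι L ρ)) q).hom x +
        (groupCohomology.map (MonoidHom.id Γ) (𝟙 (coeffRep ι L ρ)) q).hom x = _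
      rw [ih, groupCohomology.map_id]
      rfl
  exact hns _

/-- Hence `T_g` is injective on `H^q(S_L, Ṽ)` whenever `deg(g⁻¹)` acts injectively (e.g. over a
field of characteristic `0`). [folklore] -/
theorem heckeEnd_injective_of_conj {g : 𝒢} (hg : ∀ l ∈ L, g⁻¹ * l * g ∈ L)
    (hfin : (ArithmeticQuotient.doubleCosetQuot L g⁻¹).Finite) (q : ℕ)
    (hreg : ∀ x : cohomology ι L ρ q, hfin.toFinset.card • x = 0 → x = 0) :
    Function.Injective (heckeEnd ι L ρ g q) := by
  intro x y hxy
  have h := congrArg (heckeEnd ι L ρ g⁻¹ q) hxy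
  rw [heckeEnd_inv_apply_heckeEnd_of_conj ι L ρ hg hfin, heckeEnd_inv_apply_heckeEnd_of_conj ι L ρ hg hfin]
    at h
  have h0 : hfin.toFinset.card • (x - y) = 0 := by rw [smul_sub, h, sub_self]
  exact sub_eq_zero.1 (hreg _ h0)

end TwistedQuotient

end Literature.NumberTheory.Automorphic
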